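import Literature.NumberTheory.EllipticCurves.DivisionFieldRamificationPotMultProofs
import Literature.NumberTheory.EllipticCurves.DivisionFieldRamificationPrimePowProofs
import HarnessLib

/-!
# Division fields at potentially multiplicative places, EVERY level `n`: `e(Q ∣ v) ∣ 2n`

`Proofs` file (theorems only: no definition, no named fact), topic `NumberTheory/EllipticCurves`;
sequel of `DivisionFieldRamificationPotMultProofs` (prime level: `e(Q ∣ v) ∣ 2p`) and of
`DivisionFieldRamificationPrimePowProofs` (`e(Q ∣ v) ∣ n` at a MULTIPLICATIVE place, every level `n`
prime to `v`, via the global Tate basis).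

Let `E/K` be an elliptic curve over a number field, `n ≥ 1`, `L ⊆ K̄` a finite Galois subextension of
`K` with `L ⊆ K(E[n])` (`ker ρ̄_{E,n} ≤ Gal(K̄/L)`), `v` a finite place with `(n : 𝓞 K) ∉ v` ("`n`
invertible in `O_v`"), and suppose `E` has POTENTIALLY MULTIPLICATIVE reduction at `v`: some quadratic
twist `E^{(d)}` (`d ∈ K^×`) has multiplicative reduction at `v`, equivalently `ord_v(j(E)) < 0`.  Then for
every prime `Q` of `𝓞 L` over `v`:

* `WeierstrassCurve.ramificationIdx_divisionField_dvd_two_mul_level_of_hasMultiplicativeReductionAt_quadraticTwist`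
  — **`e(Q ∣ v) ∣ 2n`** (Serre 1972 §1.11–1.12; Silverman *ATAEC* V.5: over `K_v(√d)` the curve is a
  Tate curve, inertia acts through `(1 *; 0 1)`);
* `…_dvd_two_mul_level_of_one_lt_valuation_j` — the same from `ord_v(j(E)) < 0`;
* `…not_dvd_ramificationIdx_divisionField_level_…` — no prime `q ∤ 2n` divides `e(Q ∣ v)` (tameness
  away from `2n`);
* `…_of_algHom` variants — the standalone-field currency (`M/K` Galois presented by `ψ : M → K̄` inside
  `K(E[n])`, the shape of the cell's genuine towers `Cor22.exists_ramificationIdx_divisionTower_eq_pow`).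

Route (it subsumes the prime-level exponent argument of the predecessor file): with `r` the restriction
`Γ_K → Gal(L/K)`, `I = I_𝔓` the inertia group of a prime `𝔓 ∣ v` of `\bar ℤ_K` and `N = Γ_{K(√d)}`
(normal of index dividing `2`, the tree's `index_stabilizer_geomSqrt`):
`e(Q ∣ v) = #r(I)` (`map_restrictNormalHom_inertia_eq`), `#r(I) ∣ 2·#r(N ∩ I)` (second isomorphism
theorem: the generic `Literature.NumberTheory.EllipticCurves.natCard_map_dvd_two_mul_natCard_map_inf`),
`#r(N ∩ I) ∣ #ρ̄_{E,n}(N ∩ I)` (`ker ρ̄_{E,n} ≤ ker r`), `#ρ̄_{E,n}(N ∩ I) ∣ #ρ̄_{E^{(d)},n}(N ∩ I)` (on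
`N` the two kernels agree, `WeierstrassCurve.ker_galoisRepTorsion_quadraticTwist_inf_stabilizer_le`,
through the `Γ_{K(√d)}`-equivariant `E^{(d)}(K̄) ≃+ E(K̄)` of `exists_addEquiv_geomPoints_quadraticTwist_sign`),
and `#ρ̄_{E^{(d)},n}(I) ∣ n` is the tree's `natCard_map_inertia_galoisRepTorsion_dvd` for the twist.

Consumer (cell abc-iut, sub-cell R-W: W-neg-1's LOCAL-TYPE LEMMA input (a), `n = 15`; HEX-SHARP):
classical algebraic number theory; nothing here bears on [IUTchIII] Cor. 3.12.

## References

* [Serre1972] J.-P. Serre, Propriétés galoisiennes des points d'ordre fini des courbes elliptiques,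
  Invent. Math. 15 (1972), §1.11–§1.12.
* [SilvermanATAEC1994] J. H. Silverman, *Advanced Topics in the Arithmetic of Elliptic Curves* (1994),
  V.4–V.5, Thm. 5.3, Exercise 5.13 (b).
* [SilvermanAEC2009] J. H. Silverman, *The Arithmetic of Elliptic Curves*, 2nd ed. (2009), X.5 Cor. 5.4.
* [NeukirchANT1999] J. Neukirch, *Algebraic Number Theory* (1999), Ch. I §8 (8.2), §9 (9.6), (9.9).
-/

noncomputable section

open scoped Pointwise IntermediateField NumberField

open NumberField IsDedekindDomain IntermediateField Field

universe u

/-! ### Group theory: index-two descent in cardinality form -/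

namespace Literature.NumberTheory.EllipticCurves

/-- **Index-two descent, cardinality form** (second isomorphism theorem): for a homomorphism `r` out of
`Γ`, a subgroup `I ≤ Γ` and a NORMAL subgroup `N ⊴ Γ` of index dividing `2`,
`#r(I) ∣ 2 · #r(N ∩ I)` — since `#r(I) = [I : I ∩ ker r] ∣ [I : I ∩ N ∩ ker r] = [I : I ∩ N]·#r(N ∩ I)`
and `[I : I ∩ N] ∣ [Γ : N]`. [cite: NeukirchANT1999, Ch. I §9 (9.9)] -/
theorem natCard_map_dvd_two_mul_natCard_map_inf {Γ G : Type*} [Group Γ] [Group G] (r : Γ →* G)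
    (I N : Subgroup Γ) [N.Normal] (hN : N.index ∣ 2) :
    Nat.card (I.map r) ∣ 2 * Nat.card ((N ⊓ I).map r) := by
  rw [natCard_map_eq_index_subgroupOf, natCard_map_eq_index_subgroupOf]
  change r.ker.relIndex I ∣ 2 * r.ker.relIndex (N ⊓ I)
  have h1 : r.ker.relIndex I ∣ (r.ker ⊓ N).relIndex I :=
    Subgroup.relIndex_dvd_of_le_left I (inf_le_left : r.ker ⊓ N ≤ r.ker)
  have h2 : (r.ker ⊓ N).relIndex I = r.ker.relIndex (N ⊓ I) * N.relIndex I :=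
    (Subgroup.relIndex_inf_mul_relIndex r.ker N I).symm
  have h3 : N.relIndex I ∣ 2 := (Subgroup.relIndex_dvd_index_of_normal N I).trans hN
  rw [h2] at h1
  calc r.ker.relIndex I ∣ r.ker.relIndex (N ⊓ I) * N.relIndex I := h1
    _ ∣ r.ker.relIndex (N ⊓ I) * 2 := mul_dvd_mul_left _ h3
    _ = 2 * r.ker.relIndex (N ⊓ I) := mul_comm _ _

end Literature.NumberTheory.EllipticCurves

namespace WeierstrassCurve

open Literature.NumberTheory.EllipticCurves Literature.NumberTheory.GaloisRepresentations
  Literature.NumberTheory.NumberFields IsDedekindDomain.HeightOneSpectrum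

variable {K : Type u} [Field K] [NumberField K] (W : WeierstrassCurve K)

/-- **On `Γ_{K(√d)}` the kernels of `ρ̄_{E^{(d)},n}` and `ρ̄_{E,n}` agree** (one inclusion): an element
of `Γ_K` fixing `√d` and every `n`-torsion point of the twist `E^{(d)}` fixes every `n`-torsion point of
`E`, along the `Γ_{K(√d)}`-equivariant isomorphism `E^{(d)}(K̄) ≃+ E(K̄)`
(`exists_addEquiv_geomPoints_quadraticTwist_sign`). [cite: SilvermanAEC2009, X.5 Cor. 5.4] -/
theorem ker_galoisRepTorsion_quadraticTwist_inf_stabilizer_le (n : ℤ) {d : K} (hd : d ≠ 0) :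
    ((W.quadraticTwist d).galoisRepTorsion n).ker ⊓
        MulAction.stabilizer (absoluteGaloisGroup K) (geomSqrt d) ≤
      (W.galoisRepTorsion n).ker := by
  intro σ hσ
  obtain ⟨hker, hσd⟩ := Subgroup.mem_inf.mp hσ
  rw [MonoidHom.mem_ker] at hker ⊢
  have hσd' : σ • geomSqrt d = geomSqrt d := MulAction.mem_stabilizer_iff.mp hσd
  have key : ∀ P : geomTorsion (W.quadraticTwist d) n, σ • P = P := fun P ↦ by
    rw [← galoisRepTorsion_apply, hker]
    rfl
  obtain ⟨f, hfpos, -⟩ := W.exists_addEquiv_geomPoints_quadraticTwist_sign hd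
  refine Multiplicative.toAdd.injective (AddEquiv.ext fun Q ↦ ?_)
  rw [galoisRepTorsion_apply]
  change σ • Q = Q
  have hQ' : f.symm (Q : geomPoints W) ∈ geomTorsion (W.quadraticTwist d) n := by
    have h : n • f.symm (Q : geomPoints W) = 0 := by
      apply f.injective
      rw [map_zsmul, AddEquiv.apply_symm_apply, map_zero]
      exact (Submodule.mem_torsionBy_iff n Q.1).mp Q.2
    exact (Submodule.mem_torsionBy_iff n _).mpr h
  apply Subtype.ext
  have h1 := key ⟨f.symm (Q : geomPoints W), hQ'⟩
  have h2 := congrArg (fun P : geomTorsion (W.quadraticTwist d) n ↦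
    f (P : geomPoints (W.quadraticTwist d))) h1
  simp only at h2
  change f (σ • f.symm (Q : geomPoints W)) = f (f.symm (Q : geomPoints W)) at h2
  rw [hfpos σ hσd', AddEquiv.apply_symm_apply] at h2
  exact h2

/-- **Division fields at potentially multiplicative places: `e(Q ∣ v) ∣ 2n` at EVERY level `n` prime to
`v`.**  Let `E/K` be elliptic over a number field, `n ≥ 1` with `(n : 𝓞 K) ∉ v`, `L ⊆ K̄` finite Galois
over `K` with `L ⊆ K(E[n])` (`ker ρ̄_{E,n} ≤ Gal(K̄/L)`), and `d ∈ K^×` with `E^{(d)}` of multiplicative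
reduction at `v`.  Then `e(Q ∣ v) ∣ 2n` for every prime `Q` of `𝓞 L` over `v`: with `r` the restriction
to `L`, `I = I_𝔓` (`𝔓 ∣ v`) and `N = Γ_{K(√d)}`, `e = #r(I) ∣ 2·#r(N ∩ I)`
(`natCard_map_dvd_two_mul_natCard_map_inf`), `#r(N ∩ I) ∣ #ρ̄_{E,n}(N ∩ I) ∣ #ρ̄_{E^{(d)},n}(N ∩ I) ∣
#ρ̄_{E^{(d)},n}(I) ∣ n` (`natCard_map_dvd_of_ker_inf_le` twice,
`ker_galoisRepTorsion_quadraticTwist_inf_stabilizer_le`, and the tree's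
`natCard_map_inertia_galoisRepTorsion_dvd` for the twist).  Subsumes the prime-level theorem.
[cite: Serre1972, §1.11–§1.12] [cite: SilvermanATAEC1994, V.4–V.5 and Exercise 5.13 (b)]
[cite: NeukirchANT1999, Ch. I §9 (9.6), (9.9)] -/
theorem ramificationIdx_divisionField_dvd_two_mul_level_of_hasMultiplicativeReductionAt_quadraticTwist
    [W.IsElliptic] {n : ℕ} (L : IntermediateField K (AlgebraicClosure K)) [FiniteDimensional K L]
    [IsGalois K L] (hL : (W.galoisRepTorsion (n : ℤ)).ker ≤ L.fixingSubgroup)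
    {v : HeightOneSpectrum (𝓞 K)} {d : K} (hd : d ≠ 0)
    (hv : (W.quadraticTwist d).HasMultiplicativeReductionAt v) (hnv : (n : 𝓞 K) ∉ v.asIdeal)
    (Q : Ideal (𝓞 L)) [Q.IsPrime] [Q.LiesOver v.asIdeal] :
    Q.ramificationIdx (𝓞 K) ∣ 2 * n := by
  haveI : (W.quadraticTwist d).IsElliptic := W.isElliptic_quadraticTwist hd
  obtain ⟨𝔓, h𝔓⟩ := HeightOneSpectrum.primesAbove_nonempty v
  set r : (AlgebraicClosure K ≃ₐ[K] AlgebraicClosure K) →* (L ≃ₐ[K] L) :=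
    AlgEquiv.restrictNormalHom L with hr
  set I : Subgroup (absoluteGaloisGroup K) := 𝔓.inertia (absoluteGaloisGroup K) with hI
  set N : Subgroup (absoluteGaloisGroup K) :=
    MulAction.stabilizer (absoluteGaloisGroup K) (geomSqrt d) with hNdef
  have hNn : N.Normal := stabilizer_geomSqrt_normal d
  have hN2 : N.index ∣ 2 := by
    rcases index_stabilizer_geomSqrt (K := K) d with h | h
    · rw [hNdef, h]; exact one_dvd 2
    · rw [hNdef, h]
  -- `e(Q ∣ v) = #r(I_𝔓)`
  have he : Q.ramificationIdx (𝓞 K) = Nat.card (I.map r) := by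
    rw [@ramificationIdx_eq_card_inertia_comap K _ _ L _ _ v 𝔓 h𝔓.1 h𝔓.2 Q _ _,
      ← @map_restrictNormalHom_inertia_eq K _ _ L _ _ 𝔓 h𝔓.1]
    rfl
  -- `#r(I) ∣ 2 · #r(N ∩ I)`
  have h1 : Nat.card (I.map r) ∣ 2 * Nat.card ((N ⊓ I).map r) :=
    @natCard_map_dvd_two_mul_natCard_map_inf _ _ _ _ r I N hNn hN2
  -- `#r(N ∩ I) ∣ #ρ̄_{E,n}(N ∩ I)`: `ker ρ̄_{E,n} ≤ Gal(K̄/L) = ker r`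
  have h2 : Nat.card ((N ⊓ I).map r) ∣ Nat.card ((N ⊓ I).map (W.galoisRepTorsion (n : ℤ))) := by
    refine natCard_map_dvd_of_ker_inf_le _ _ _ (le_trans inf_le_left (le_trans hL ?_))
    rw [hr, IntermediateField.restrictNormalHom_ker]
  -- `#ρ̄_{E,n}(N ∩ I) ∣ #ρ̄_{E^{(d)},n}(N ∩ I)`: on `N` the kernels agree
  have h3 : Nat.card ((N ⊓ I).map (W.galoisRepTorsion (n : ℤ))) ∣
      Nat.card ((N ⊓ I).map ((W.quadraticTwist d).galoisRepTorsion (n : ℤ))) := by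
    refine natCard_map_dvd_of_ker_inf_le _ _ _ ?_
    calc ((W.quadraticTwist d).galoisRepTorsion (n : ℤ)).ker ⊓ (N ⊓ I)
        ≤ ((W.quadraticTwist d).galoisRepTorsion (n : ℤ)).ker ⊓ N :=
          inf_le_inf_left _ inf_le_left
      _ ≤ (W.galoisRepTorsion (n : ℤ)).ker := W.ker_galoisRepTorsion_quadraticTwist_inf_stabilizer_le _ hd
  -- `#ρ̄_{E^{(d)},n}(N ∩ I) ∣ #ρ̄_{E^{(d)},n}(I) ∣ n`
  have h4 : Nat.card ((N ⊓ I).map ((W.quadraticTwist d).galoisRepTorsion (n : ℤ))) ∣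
      Nat.card (I.map ((W.quadraticTwist d).galoisRepTorsion (n : ℤ))) :=
    Subgroup.card_dvd_of_le (Subgroup.map_mono inf_le_right)
  have h5 : Nat.card (I.map ((W.quadraticTwist d).galoisRepTorsion (n : ℤ))) ∣ n :=
    (W.quadraticTwist d).natCard_map_inertia_galoisRepTorsion_dvd hv hnv h𝔓
  rw [he]
  exact h1.trans (mul_dvd_mul_left 2 (h2.trans (h3.trans (h4.trans h5))))

/-- **`ord_v(j(E)) < 0`, `(n : 𝓞 K) ∉ v` ⇒ `e(Q ∣ v) ∣ 2n` in `K(E[n])`** (Mathlib normalisation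
`1 < v(j)`; some quadratic twist is multiplicative at `v`, the tree's
`exists_hasMultiplicativeReductionAt_quadraticTwist_of_one_lt_valuation_j`).
[cite: Serre1972, §1.11–§1.12] [cite: SilvermanATAEC1994, V.5 Thm. 5.3 and Exercise 5.13 (b)] -/
theorem ramificationIdx_divisionField_dvd_two_mul_level_of_one_lt_valuation_j
    [W.IsElliptic] {n : ℕ} (L : IntermediateField K (AlgebraicClosure K)) [FiniteDimensional K L]
    [IsGalois K L] (hL : (W.galoisRepTorsion (n : ℤ)).ker ≤ L.fixingSubgroup)
    {v : HeightOneSpectrum (𝓞 K)} (hj : 1 < v.valuation K W.j) (hnv : (n : 𝓞 K) ∉ v.asIdeal)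
    (Q : Ideal (𝓞 L)) [Q.IsPrime] [Q.LiesOver v.asIdeal] :
    Q.ramificationIdx (𝓞 K) ∣ 2 * n := by
  obtain ⟨d, hd, hv⟩ := W.exists_hasMultiplicativeReductionAt_quadraticTwist_of_one_lt_valuation_j v hj
  exact W.ramificationIdx_divisionField_dvd_two_mul_level_of_hasMultiplicativeReductionAt_quadraticTwist
    L hL hd hv hnv Q

/-- **No `q ∤ 2n` divides `e(Q ∣ v)`** at a potentially multiplicative place `v` with
`(n : 𝓞 K) ∉ v` — in particular the residue characteristic of `v` does not when `v ∤ 2n` (tameness).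
[cite: Serre1972, §1.11–§1.12] -/
theorem not_dvd_ramificationIdx_divisionField_level_of_hasMultiplicativeReductionAt_quadraticTwist
    [W.IsElliptic] {n : ℕ} (L : IntermediateField K (AlgebraicClosure K)) [FiniteDimensional K L]
    [IsGalois K L] (hL : (W.galoisRepTorsion (n : ℤ)).ker ≤ L.fixingSubgroup)
    {v : HeightOneSpectrum (𝓞 K)} {d : K} (hd : d ≠ 0)
    (hv : (W.quadraticTwist d).HasMultiplicativeReductionAt v) (hnv : (n : 𝓞 K) ∉ v.asIdeal)
    (Q : Ideal (𝓞 L)) [Q.IsPrime] [Q.LiesOver v.asIdeal] {q : ℕ} (hqn : ¬ q ∣ 2 * n) :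
    ¬ q ∣ Q.ramificationIdx (𝓞 K) := fun h ↦
  hqn (h.trans
    (W.ramificationIdx_divisionField_dvd_two_mul_level_of_hasMultiplicativeReductionAt_quadraticTwist
      L hL hd hv hnv Q))

/-- **`e(u ∣ v) ∣ 2n` for an abstractly given `M/K`** (standalone-field currency at every level): `M` a
number field Galois over `K` with a `K`-embedding `ψ : M → K̄` whose image is fixed by `ker ρ̄_{E,n}`,
`v` a place with `(n : 𝓞 K) ∉ v` at which some quadratic twist `E^{(d)}` is multiplicative, `u` a place
of `M` over `v`. [cite: Serre1972, §1.11–§1.12] [cite: NeukirchANT1999, Ch. I §8 (8.2)] -/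
theorem ramificationIdx_dvd_two_mul_level_of_hasMultiplicativeReductionAt_quadraticTwist_of_algHom
    [W.IsElliptic] {n : ℕ} {M : Type u} [Field M] [NumberField M] [Algebra K M] [IsGalois K M]
    (ψ : M →ₐ[K] AlgebraicClosure K)
    (hM : (W.galoisRepTorsion (n : ℤ)).ker ≤ ψ.fieldRange.fixingSubgroup)
    {v : HeightOneSpectrum (𝓞 K)} {d : K} (hd : d ≠ 0)
    (hv : (W.quadraticTwist d).HasMultiplicativeReductionAt v) (hnv : (n : 𝓞 K) ∉ v.asIdeal)
    (u : HeightOneSpectrum (𝓞 M)) [u.asIdeal.LiesOver v.asIdeal] :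
    u.asIdeal.ramificationIdx (𝓞 K) ∣ 2 * n := by
  haveI : FiniteDimensional K M := Module.Finite.of_restrictScalars_finite ℚ K M
  let e : M ≃ₐ[K] ψ.fieldRange :=
    ((IntermediateField.topEquiv (F := K) (E := M)).symm.trans (IntermediateField.equivMap ⊤ ψ)).trans
      (IntermediateField.equivOfEq (AlgHom.fieldRange_eq_map ψ).symm)
  haveI : FiniteDimensional K ψ.fieldRange := LinearEquiv.finiteDimensional e.toLinearEquiv
  haveI : IsGalois K ψ.fieldRange := IsGalois.of_algEquiv e
  haveI : NumberField ψ.fieldRange := NumberField.of_module_finite K ψ.fieldRange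
  set Q : Ideal (𝓞 ψ.fieldRange) :=
    u.asIdeal.map (RingOfIntegers.mapAlgEquiv e : 𝓞 M ≃ₐ[𝓞 K] 𝓞 ψ.fieldRange) with hQ
  haveI : Q.IsPrime := isPrime_map_mapAlgEquiv e u
  haveI : Q.LiesOver v.asIdeal := liesOver_map_mapAlgEquiv e u _
  rw [← ramificationIdx_map_mapAlgEquiv e u]
  exact W.ramificationIdx_divisionField_dvd_two_mul_level_of_hasMultiplicativeReductionAt_quadraticTwist
    ψ.fieldRange hM hd hv hnv Q

/-- **`e(u ∣ v) ∣ 2n` for an abstractly given `M/K` at a place with `ord_v(j(E)) < 0`**, `(n : 𝓞 K) ∉ v`.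
[cite: Serre1972, §1.11–§1.12] [cite: SilvermanATAEC1994, V.5 Thm. 5.3 and Exercise 5.13 (b)] -/
theorem ramificationIdx_dvd_two_mul_level_of_one_lt_valuation_j_of_algHom
    [W.IsElliptic] {n : ℕ} {M : Type u} [Field M] [NumberField M] [Algebra K M] [IsGalois K M]
    (ψ : M →ₐ[K] AlgebraicClosure K)
    (hM : (W.galoisRepTorsion (n : ℤ)).ker ≤ ψ.fieldRange.fixingSubgroup)
    {v : HeightOneSpectrum (𝓞 K)} (hj : 1 < v.valuation K W.j) (hnv : (n : 𝓞 K) ∉ v.asIdeal)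
    (u : HeightOneSpectrum (𝓞 M)) [u.asIdeal.LiesOver v.asIdeal] :
    u.asIdeal.ramificationIdx (𝓞 K) ∣ 2 * n := by
  obtain ⟨d, hd, hv⟩ := W.exists_hasMultiplicativeReductionAt_quadraticTwist_of_one_lt_valuation_j v hj
  exact W.ramificationIdx_dvd_two_mul_level_of_hasMultiplicativeReductionAt_quadraticTwist_of_algHom ψ
    hM hd hv hnv u

end WeierstrassCurve

end
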